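import Literature.AlgebraicGeometry.HodgeTheory.RealMultiplicationPowersHodgeClasses
import Literature.AlgebraicGeometry.Milne1999.LefschetzGroup
import Mathlib.NumberTheory.NumberField.InfinitePlace.TotallyRealComplex
import HarnessLib

/-!
# `Hg(A) = S(A)` and `MT(A) = L(A)` for a complex abelian variety whose endomorphism algebra is a totally real field of degree `dim A` (Ribet 1983 Thm. 1 / Milne 1999 Prop. 4.8) — unconditional

Family `hodge`, layer `Literature/AlgebraicGeometry/HodgeTheory`. Research context: cell `pub-hodge-ring2`
(HONEST FRAMING: research route conditional on HC_CM; not a corollary; Q11.4-sentence-2 already refuted in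
dim ≥ 3), Literature lane, real-multiplication programme R2 — the group-theoretic reading of the
divisoriality of all powers (`RealMultiplicationPowersHodgeClasses`) through the tree's Milne lane
(`Milne1999/LefschetzGroup`, Prop. 4.8 (a) ⇒ (b), (c)). UNCONDITIONAL; no step towards a summit statement.

PUBLISHED STATEMENTS. Ribet 1983 Thm. 1 (p. 524): for `A` with `End⁰(A) = E` a totally real field and
`dim A/[E:ℚ]` odd, the Hodge group of `A` is the full centraliser of `E` in the symplectic group,
`Hg(A) = R_{E/ℚ} Sp_{2r,E}` (= the Lefschetz group `Lef(A)`; `r = 1`: `R_{E/ℚ} SL₂`); Milne 1999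
Prop. 4.8 (p. 660): «no power of `A` supports an exotic Hodge class ⟺ `Hg(A) = L(A)` ⟺ `Hg′(A) = S(A)`».
Here: the tree's `AbelianVariety.isDivisorGenerated_powSucc_of_isTotallyReal` (all powers divisorial,
Ribet Thm. 0 at relative dimension one, fact-free) fed into the tree's Milne Prop. 4.8 (a) ⇒ (c)/(b)
`AbelianVariety.hodgeGroup_eq_specialLefschetzGroup_of_forall_isDivisorGenerated` /
`AbelianVariety.mumfordTateGroup_eq_lefschetzGroup_of_forall_isDivisorGenerated` (tree vocabulary:
`hodgeGroup`, `specialLefschetzGroup`, `mumfordTateGroup`, `lefschetzGroup` of `MotivatedGaloisGroup` /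
`Milne1999/LefschetzGroup`, subgroups of `∏_k GL(Hᵏ(A(ℂ); ℂ))` fixing the rational Hodge resp. Lefschetz
classes on all powers).

MAIN RESULTS (all proved; no named fact, D-0026):
`AbelianVariety.hodgeGroup_eq_specialLefschetzGroup_of_isTotallyReal`,
`AbelianVariety.mumfordTateGroup_eq_lefschetzGroup_of_isTotallyReal`; and, for the cell's product lane
(Moonen–Zarhin 1999 Thm. (3.2)(2) / Lombardo 2016 Lemma 3.4, `HodgeGroupProductCMFactor`):
`hasNoTypeIVFactor_of_isTotallyReal` (an abelian variety whose endomorphism algebra is a totally real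
field has no factor of type IV — Albert type I) and the CONDITIONAL corollary
`hodgeConjectureFor_prod_cmType_of_isTotallyReal_of_cmHodgeHypothesis`: HC_CM ∧ the Lombardo–Moonen–Zarhin
span fact ⟹ HC(`A × C`) for such `A` (relative dimension one) and any `C` of CM type — HC(`A`) being now
unconditional.

## References

* [Ribet1983] K. A. Ribet, *Hodge classes on certain types of abelian varieties*, Amer. J. Math. 105
  (1983) 523–538, Thm. 0 and Thm. 1. [cite: Ribet1983, Thm. 0–1]
* [Milne1999LefschetzClasses] J. S. Milne, *Lefschetz classes on abelian varieties*, Duke Math. J. 96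
  (1999) 639–675, Prop. 4.8 (p. 660). [cite: Milne1999LefschetzClasses, Prop. 4.8 (p. 660)]
* [Hazama1983] F. Hazama, Tôhoku Math. J. 35 (1983) 303–308, Thm. (1.1). [cite: Hazama1983, Thm. (1.1)]
* [MoonenZarhin1999LowDim] B. Moonen, Yu. Zarhin, Math. Ann. 315 (1999), §1 and Thm. (3.2)(2).
  [cite: MoonenZarhin1999LowDim, §1 and Thm. (3.2)]
* [Lombardo2016] D. Lombardo, *On the ℓ-adic Galois representations attached to nonsimple abelian
  varieties*, Ann. Inst. Fourier 66 (2016), Lemma 3.4 (p. 1229). [cite: Lombardo2016, Lemma 3.4 (p. 1229)]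
-/

noncomputable section

open CategoryTheory Module NumberField

namespace Literature.AlgebraicGeometry.HodgeTheory

open Literature.AlgebraicGeometry.Motives (AbelianVariety)
open Literature.AlgebraicGeometry.ComplexMultiplication
open Literature.AlgebraicGeometry.Milne1999

/-- **`Hg′(A) = S(A)` (Milne Prop. 4.8 (c); Ribet 1983 Thm. 1 `Hg(A) = R_{E/ℚ} SL₂ = Lef(A)`) for a
complex abelian variety whose endomorphism algebra is a totally real field of degree `dim A`** —
unconditional: all powers are divisorial (`AbelianVariety.isDivisorGenerated_powSucc_of_isTotallyReal`)
and Milne Prop. 4.8 (a) ⇒ (c) (`AbelianVariety.hodgeGroup_eq_specialLefschetzGroup_of_forall_isDivisorGenerated`).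
[cite: Ribet1983, Thm. 1 (p. 524)] [cite: Milne1999LefschetzClasses, Prop. 4.8 (p. 660)] -/
theorem AbelianVariety.hodgeGroup_eq_specialLefschetzGroup_of_isTotallyReal (A : AbelianVariety ℂ)
    (hF : IsField A.endAlgebra) [IsTotallyReal (EndField A hF)]
    (hdeg : Module.finrank ℚ A.endAlgebra = A.dim) :
    hodgeGroup A.dim A.X = specialLefschetzGroup A.dim A.X :=
  Motives.AbelianVariety.hodgeGroup_eq_specialLefschetzGroup_of_forall_isDivisorGenerated A
    fun a => AbelianVariety.isDivisorGenerated_powSucc_of_isTotallyReal A hF hdeg a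

/-- **`Hg(A) = L(A)` (Milne Prop. 4.8 (b): the Mumford–Tate group is the Lefschetz group) for a complex
abelian variety whose endomorphism algebra is a totally real field of degree `dim A`** — unconditional.
[cite: Milne1999LefschetzClasses, Prop. 4.8 (p. 660)] [cite: Ribet1983, Thm. 1 (p. 524)] -/
theorem AbelianVariety.mumfordTateGroup_eq_lefschetzGroup_of_isTotallyReal (A : AbelianVariety ℂ)
    (hF : IsField A.endAlgebra) [IsTotallyReal (EndField A hF)]
    (hdeg : Module.finrank ℚ A.endAlgebra = A.dim) :
    mumfordTateGroup A.dim A.X = lefschetzGroup A.dim A.X :=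
  Motives.AbelianVariety.mumfordTateGroup_eq_lefschetzGroup_of_forall_isDivisorGenerated A
    fun a => AbelianVariety.isDivisorGenerated_powSucc_of_isTotallyReal A hF hdeg a

/-- In a totally real number field every element is a root of a non-zero rational polynomial (its
minimal polynomial) all of whose complex roots are real (the roots are the `φ(z)`, `φ : E → ℂ`,
`NumberField.Embeddings.range_eval_eq_rootSet_minpoly`). [folklore] -/
private theorem minpoly_roots_real_of_isTotallyReal {E : Type*} [Field E] [NumberField E]
    [IsTotallyReal E] (z : E) :
    minpoly ℚ z ≠ 0 ∧ Polynomial.aeval z (minpoly ℚ z) = 0 ∧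
      ∀ x : ℂ, Polynomial.aeval x (minpoly ℚ z) = 0 → x.im = 0 := by
  have hint : IsIntegral ℚ z := Algebra.IsIntegral.isIntegral z
  refine ⟨minpoly.ne_zero hint, minpoly.aeval ℚ z, fun x hx => ?_⟩
  have hx' : x ∈ (minpoly ℚ z).rootSet ℂ := by
    rw [Polynomial.mem_rootSet]
    exact ⟨minpoly.ne_zero hint, hx⟩
  rw [← NumberField.Embeddings.range_eval_eq_rootSet_minpoly] at hx'
  obtain ⟨φ, rfl⟩ := hx'
  have hreal := RingHom.congr_fun
    (ComplexEmbedding.isReal_iff.1 (IsTotallyReal.complexEmbedding_isReal φ)) z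
  rw [ComplexEmbedding.conjugate_coe_eq] at hreal
  exact Complex.conj_eq_iff_im.1 hreal

/-- **An abelian variety whose endomorphism algebra is a totally real field has no factor of type IV**
(Albert type I): every (central) `z ∈ End⁰(A) = E` is a root of its minimal polynomial over `ℚ`, whose
complex roots are the `φ(z)`, `φ : E → ℂ`, all real since `E` is totally real. Moonen–Zarhin §1: "no
factors of Type 4". [cite: MoonenZarhin1999LowDim, §1] [cite: Ribet1983, Thm. 0–1] -/
theorem hasNoTypeIVFactor_of_isTotallyReal (A : AbelianVariety ℂ) (hF : IsField A.endAlgebra)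
    [IsTotallyReal (EndField A hF)] : HasNoTypeIVFactor A := by
  intro z _
  let z' : EndField A hF := (EndField.toEndAlgebra hF).symm z
  obtain ⟨hne, hz, hroots⟩ := minpoly_roots_real_of_isTotallyReal z'
  let f : EndField A hF →ₐ[ℚ] A.endAlgebra := (EndField.toEndAlgebra hF).toRingHom.toRatAlgHom
  have hfz : f z' = z := rfl
  refine ⟨minpoly ℚ z', hne, ?_, hroots⟩
  rw [← hfz, Polynomial.aeval_algHom_apply, hz, map_zero]

/-- **HC_CM ∧ (Lombardo–Moonen–Zarhin span) ⟹ HC(`A × C`) for `A` with `End⁰(A)` a totally real field of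
degree `dim A` and `C` of CM type** (ring 2, route `motiv`, HONEST FRAMING: research route conditional on
HC_CM; not a corollary; Q11.4-sentence-2 already refuted in dim ≥ 3): the tree's
`hodgeConjectureFor_prod_of_cmHodgeHypothesis` with its hypothesis HC(`A`) DISCHARGED by
`AbelianVariety.isDivisorGenerated_of_isTotallyReal` (Ribet 1983 Thm. 0 at relative dimension one,
fact-free) and `HasNoTypeIVFactor A` by `hasNoTypeIVFactor_of_isTotallyReal`; the binders `hCM` (HC for CM
abelian varieties) and `hL` (`Lombardo2016_hodgeClassesProductSpan`) remain.
[cite: MoonenZarhin1999LowDim, Thm. (3.2)] [cite: Lombardo2016, Lemma 3.4 (p. 1229)] [cite: Ribet1983, Thm. 0–1] -/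
theorem hodgeConjectureFor_prod_cmType_of_isTotallyReal_of_cmHodgeHypothesis
    (hCM : ∀ B : AbelianVariety ℂ, Milne1999.CMHodgeHypothesisAt B)
    (hL : Lombardo2016_hodgeClassesProductSpan) (A C : AbelianVariety ℂ) (hF : IsField A.endAlgebra)
    [IsTotallyReal (EndField A hF)] (hdeg : Module.finrank ℚ A.endAlgebra = A.dim)
    (hCt : Milne1999.IsOfCMType C) : HodgeConjectureFor (A.prod C).dim (A.prod C).X :=
  hodgeConjectureFor_prod_of_cmHodgeHypothesis hCM hL A C (hasNoTypeIVFactor_of_isTotallyReal A hF) hCt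
    (hodgeConjectureFor_of_isDivisorGenerated A
      (AbelianVariety.isDivisorGenerated_of_isTotallyReal A hF hdeg))

end Literature.AlgebraicGeometry.HodgeTheory

end
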